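import Summits.BirchSwinnertonDyer.Rank1Residual.ManinAdditive.HesseOptimalityAtThree
import Summits.BirchSwinnertonDyer.BirchSwinnertonDyer.Theorems.ManinLocalTwoThreeShimuraIndexMuThree
import HarnessLib

/-!
# HESSE OPTIMALITY AT 3 — the CONE LEAF: the two PROVED edges that need the Shimura-index/`μ₃` dichotomy
# (cell `bsd-f2-manin`, planner an g40, FILE M §2; typer g21 cone split of T-an-52)

TYPER NOTE (typer g21, T-an-52, sibling of `HesseOptimalityAtThree.lean`).  SOURCE = HOME/an/g40/HesseOptimalityAtThree-an-g40.lean (FILE M)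
sha16 f673d250df5cb1b9.  This file holds VERBATIM the two §2 edges of FILE M that call
`Summit.BirchSwinnertonDyer.BirchSwinnertonDyer.Theorems.ManinLocalTwoThree.exists_isShortThreeTorsion_or_hasShortMuThree_of_not_shimuraIndexPrimeTo_three`
(module `Theorems.ManinLocalTwoThreeShimuraIndexMuThree`, INSIDE the `Theses.ManinLocalTwoThree` import cone — typer/README gotcha 20/96, hence
kept out of the route-independent leaf):
* `shimuraIndexPrimeToThreeAtMultiplicativeThree_of_signLemmas` — `3 ∥ N`: NO Shimura `3`-kernel, PROVED modulo the two local sign lemmas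
  E-an-226 `MuThreeSignAtThree` ∧ E-an-226♮ `ThreeTorsionSignAtThree` (tree dichotomy + es's THEOREM AL₍₃₎
  `shimuraIndexPrimeTo_of_atkinLehnerEigenvalueAt_eq_neg_one`);
* `shimuraThreeForcesRationalThreeTorsionAtTameNine_of_signLaw` — `9 ∥ N`: E-an-128 (hence E-an-221) from es's sign law E-es-72
  `MuThreeOptimalSignAtNine` ALONE.
Same namespace `…ManinAdditive.HesseOptimality`; imports the leaf + the Theorems module + HarnessLib.  Nothing asserted; no new `Prop` node.
PARTITION 0 · beyond-print theorem: no · bears_on: stmt-BirchSwinnertonDyer-22968 (C3 `ManinPrimeToThreeAtNine`).  BSD is not proved by this;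
Manin `c = 1` is not proved by this; C3 OPEN.
-/

noncomputable section

open scoped Classical MatrixGroups ModularForm ComplexConjugate

open CongruenceSubgroup Complex WeierstrassCurve UpperHalfPlane Field Literature.NumberTheory.EllipticCurves
  Literature.NumberTheory.EllipticCurves.ModularForms

namespace Summit.BirchSwinnertonDyer.Rank1Residual.ManinAdditive.HesseOptimality

open Summit.BirchSwinnertonDyer.Rank1Residual.ManinAdditive.KatoCurve
  Summit.BirchSwinnertonDyer.Rank1Residual.ManinAdditive.CuspidalKummer
  Summit.BirchSwinnertonDyer.Rank1Residual.ManinAdditive.CuspidalKummerThree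
  Summit.BirchSwinnertonDyer.BirchSwinnertonDyer.Theorems.ManinLocalTwoThree

/-! ### §2. PROVED edges -/

/-- **`3 ∥ N`: NO Shimura `3`-kernel at all (PROVED modulo the two local sign lemmas).**  `¬ SIP₃` ⟹ (tree dichotomy, Katz /
Ribet) a rational `3`-torsion point or `μ₃ ⊂ W` ⟹ (E-an-226♮ / E-an-226) `λ₃(f) = −1` ⟹ (es's THEOREM AL₍₃₎
`shimuraIndexPrimeTo_of_atkinLehnerEigenvalueAt_eq_neg_one`, `27 ∤ N`) `SIP₃` — contradiction. -/
theorem shimuraIndexPrimeToThreeAtMultiplicativeThree_of_signLemmas (h226 : MuThreeSignAtThree)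
    (h226T : ThreeTorsionSignAtThree) : ShimuraIndexPrimeToThreeAtMultiplicativeThree := by
  intro W _ _ N _ D h3 h9
  have h27 : ¬ 3 ^ 3 ∣ N := fun h ↦ h9 ((pow_dvd_pow 3 (by norm_num : 2 ≤ 3)).trans h)
  by_contra hS
  have hε : atkinLehnerEigenvalueAt D.f 3 = -1 := by
    rcases exists_isShortThreeTorsion_or_hasShortMuThree_of_not_shimuraIndexPrimeTo_three W D.isNewformOf hS
        D.maninConstant_ne_zero_holds with hT | hμ
    · exact h226T W D h3 h9 hT
    · exact h226 W D h3 h9 hμ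
  exact hS (shimuraIndexPrimeTo_of_atkinLehnerEigenvalueAt_eq_neg_one D.f Nat.prime_three (by decide) h3 h27 hε)

/-- **`9 ∥ N`: E-an-128 (hence E-an-221) from es's SIGN LAW E-es-72 alone (PROVED).**  `¬ SIP₃` ⟹ `3`-torsion (done) or
`μ₃ ⊂ W`; in the latter case either a `3`-torsion point exists (done) or E-es-72 gives `λ₃ = −1` and THEOREM AL₍₃₎ gives
`SIP₃` — contradiction. -/
theorem shimuraThreeForcesRationalThreeTorsionAtTameNine_of_signLaw (h72 : MuThreeOptimalSignAtNine) :
    ShimuraThreeForcesRationalThreeTorsionAtTameNine := by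
  intro W _ _ N _ D hopt h9 h27 hS
  have h3 : 3 ∣ N := (dvd_pow_self 3 two_ne_zero).trans h9
  by_contra hT
  push Not at hT
  rcases exists_isShortThreeTorsion_or_hasShortMuThree_of_not_shimuraIndexPrimeTo_three W D.isNewformOf hS
      D.maninConstant_ne_zero_holds with ⟨X₀, Y₀, h⟩ | hμ
  · exact hT X₀ Y₀ h
  · exact hS (shimuraIndexPrimeTo_of_atkinLehnerEigenvalueAt_eq_neg_one D.f Nat.prime_three (by decide) h3 h27
      (h72 W D hopt h9 h27 hμ hT))

end Summit.BirchSwinnertonDyer.Rank1Residual.ManinAdditive.HesseOptimality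

end
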